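import Summits.BirchSwinnertonDyer.BirchSwinnertonDyer.Theorems.ErratumRoadFiveTorsionReductionAlgebra
import Literature.NumberTheory.EllipticCurves.Skinner2016.HidaCongruentMembers
import Literature.NumberTheory.EllipticCurves.PadicCoeffIntegersFrobeniusData
import Summits.BirchSwinnertonDyer.BirchSwinnertonDyer.Theorems.ErratumRoadFiveIrrKNoFixedTorsion
import HarnessLib

/-!
# `E[p] ↪ ρ̄_{g_m}`: an injective `Γ_ℚ`-equivariant additive map from `E[p]` to the residual representation
# `(𝒪_m/ϖ)²` of a Hida member `g_m` (footnote 1 of the erratum: «`ρ̄_{g_m} ≃ E[p]`»), built from the member's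
# congruence `A_{g_m}[p^m] ≃ (E[p^∞] ⊗ 𝒪_m)[p^m]` (helper, `--supports stmt-BirchSwinnertonDyer-23253`)

Cell `bsd-stepL`, seat `bsd-stepL-imc-p1` (prover g27, 2026-08-28). Theorems only (no definition, no named fact, no
`sorry`, no instance, no notation). Part 2b of the bridge «`Surj W p` ⟹ `ρ̄_{g_m}|_{G_K}` irreducible» (part 1:
`ErratumRoadFiveTransvectionIrreducibility.lean`; part 2a, the generic algebra: `ErratumRoadFiveTorsionReductionAlgebra.lean`;
part 3: `ErratumRoadFiveSurjIrrK.lean`).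

For a member `D : Skinner2016.HidaCongruentMember W p m` (`m ≥ 1`; `𝒪 = 𝒪_m`, `ϖ` the datum's uniformiser):

* `exists_mul_varpi_eq_natCast` — `p = yϖ` with `y ∉ p𝒪`; `dvd_of_smul_primaryTorsion_eq_zero` — an element of `ℤ_p`
  killing a non-zero point of `E[p^∞]` lies in `(p)`.
* `exists_geomTorsion_curveCoeffTorsion_hom` (step 1) — `P ↦ y ⊗ P ∈ (E[p^∞] ⊗_{ℤ_p} 𝒪)[p^m]` is additive, injective
  (`y ⊗ P = 0` would force `y ∈ p𝒪`, i.e. `ϖ ∈ 𝒪ˣ`; `𝒪` is `ℤ_p`-free), killed by `ϖ`, and `Γ_ℚ`-equivariant.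
* **`exists_geomTorsion_residual_hom`** — an injective additive `Θ : E[p] → (𝒪/ϖ)²` with `Θ(σ P) = ρ̄_{g_m}(σ) Θ(P)` for
  all `σ ∈ Γ_ℚ` (`ρ̄_{g_m} = residualRep D.Δ`): `Θ = Θ₀ ∘ e⁻¹ ∘ (y ⊗ ·)`, `e = D.e` the member's `𝒪[Γ_ℚ]`-isomorphism
  `A_{g_m}[p^m] ≃ (E[p^∞] ⊗_{ℤ_p} 𝒪)[p^m]` (§3.1 (b)), `Θ₀ : A_{g_m}[ϖ] ↪ (𝒪/ϖ)²` the reduction map (part 2a).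

HONEST FRAMING: module algebra on the tree's carriers; nothing about `L`-functions or BSD for any pair; closes: none (T7).

## References
* [Castella2018Erratum] proof of Thm. 1.1, (b) and footnote 1 (p. 4: «`ρ̄_{g_m} ≃ E[p]`»).
* [Skinner2016PacificMC] §2.6 (2-6-1), §3.1 (b) (p. 192).
* [EmertonPollackWeston2006] §3.1 (p. 17: `T̄_f = T_f/π`, `A_f = K/𝒪 ⊗ T_f`).
-/

noncomputable section

set_option autoImplicit false
-- D-0017: single-problem summit, the namespace repeats the problem name by design.
set_option linter.dupNamespace false

namespace Summit.BirchSwinnertonDyer.BirchSwinnertonDyer.Theorems.SurjIrrK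

open Literature.NumberTheory.GaloisRepresentations Literature.NumberTheory.EllipticCurves
  Literature.NumberTheory.EllipticCurves.GreenbergSelmer Literature.NumberTheory.EllipticCurves.ModularForms
  Literature.NumberTheory.EllipticCurves.BigGaloisRep Field
  Summit.BirchSwinnertonDyer.BirchSwinnertonDyer.Theorems.ErratumThm23TwoVariable

/-! ## §1 The uniformiser: `p = yϖ`, `y ∉ p𝒪`; annihilators of points of `E[p^∞]` -/

section Datum

variable {M : ℕ} {k : ℤ} {g : CuspForm (CongruenceSubgroup.Gamma0 M) k} {p : ℕ} [Fact p.Prime]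
  {ι : coeffField g →+* PadicAlgCl p} (Δ : OrdinaryNewformDatum g p ι)

/-- **`p = yϖ` with `y ∉ p𝒪`** for the datum's uniformiser `ϖ` (`p ∈ (ϖ)`; and `y ∈ p𝒪` would make `ϖ` a unit, while
`𝒪/ϖ ≠ 0`). [cite: EmertonPollackWeston2006, §3.1 (p. 17, "fix also a uniformizer `π` of `𝒪`")] -/
theorem exists_mul_varpi_eq_natCast :
    ∃ y : padicCoeffIntegers ι, y * Δ.ϖ = (p : padicCoeffIntegers ι) ∧
      ∀ d : padicCoeffIntegers ι, y ≠ (p : padicCoeffIntegers ι) * d := by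
  obtain ⟨y, hy⟩ := Ideal.mem_span_singleton'.1 (IrrK.natCast_p_mem_span_varpi Δ)
  refine ⟨y, hy, fun d hd ↦ ?_⟩
  have hp0 : (p : padicCoeffIntegers ι) ≠ 0 := fun h ↦ by
    have h' : ((p : ℕ) : padicCoeffField ι) = 0 := by exact_mod_cast congrArg Subtype.val h
    exact (Nat.cast_ne_zero.2 (Fact.out : p.Prime).ne_zero) h'
  -- `p = y ϖ = p d ϖ`, so `d ϖ = 1`
  have h1 : (p : padicCoeffIntegers ι) * (d * Δ.ϖ - 1) = 0 := by
    rw [mul_sub, mul_one, ← mul_assoc, ← hd, hy, sub_self]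
  have hunit : IsUnit Δ.ϖ :=
    IsUnit.of_mul_eq_one_right d (sub_eq_zero.1 ((mul_eq_zero.1 h1).resolve_left hp0))
  have htop : Ideal.span {Δ.ϖ} = ⊤ := Ideal.span_singleton_eq_top.2 hunit
  exact (Ideal.Quotient.nontrivial_iff.1 (IrrK.nontrivial_residue Δ)) htop

end Datum


/-! ## §2 For a Hida member `g_m`: `E[p] ↪ ρ̄_{g_m}` equivariantly -/

section Member

variable {W : WeierstrassCurve ℚ} [W.IsGloballyMinimal] {p : ℕ} [Fact p.Prime] {m : ℕ}

omit [W.IsGloballyMinimal] in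
/-- An element of `ℤ_p` killing a NON-ZERO element of `E[p]` (inside `E[p^∞]`) is divisible by `p` (else it is a unit).
[cite: Serre1968, Ch. I §1.2 (`E_{ℓ^∞}` as a `ℤ_ℓ`-module)] -/
theorem dvd_of_smul_primaryTorsion_eq_zero {a : PrimaryTorsion (WeierstrassCurve.geomPoints W) p} (ha : a ≠ 0)
    {r : ℤ_[p]} (hr : r • a = 0) : (p : ℤ_[p]) ∣ r := by
  by_contra hdiv
  have hnorm : ‖r‖ = 1 := le_antisymm r.norm_le_one (not_lt.1 fun h ↦ hdiv ((PadicInt.norm_lt_one_iff_dvd r).1 h))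
  obtain ⟨u, rfl⟩ := PadicInt.isUnit_iff.2 hnorm
  apply ha
  calc a = ((u⁻¹ : ℤ_[p]ˣ) : ℤ_[p]) • ((u : ℤ_[p]) • a) := by rw [smul_smul, Units.inv_mul, one_smul]
    _ = 0 := by rw [hr, smul_zero]

/-- **Step 1 — the `E`-side: `P ↦ y ⊗ P ∈ (E[p^∞] ⊗_{ℤ_p} 𝒪_m)[p^m]`** for `y ϖ = p`: an injective additive map
`β : E[p] → (E[p^∞] ⊗ 𝒪_m)[p^m]`, killed by `ϖ`, intertwining the Galois actions (`σ(y ⊗ P) = y ⊗ σP`); injective because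
`y ⊗ P = 0` with `P ≠ 0` would put `y = p/ϖ` in `p𝒪_m` (`𝒪_m` is `ℤ_p`-free), making `ϖ` a unit.
[cite: Skinner2016PacificMC, §2.6 (2-6-1) (`T_f = T_pE ⊗ 𝒪` as an `𝒪[G_ℚ]`-module)] -/
theorem exists_geomTorsion_curveCoeffTorsion_hom [NeZero (W.conductorNorm ℤ / p)]
    (D : Skinner2016.HidaCongruentMember W p m) (hm : 1 ≤ m) (y : padicCoeffIntegers D.ι)
    (hy : y * D.Δ.ϖ = (p : padicCoeffIntegers D.ι)) (hyp : ∀ d : padicCoeffIntegers D.ι, y ≠ (p : padicCoeffIntegers D.ι) * d) :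
    ∃ β : W.geomTorsion p →+ Skinner2016.CurveCoeffTorsion (p := p) W D.ι m,
      Function.Injective β ∧
      (∀ P, D.Δ.ϖ • (β P : Skinner2016.CurveCoeffModule (p := p) W D.ι) = 0) ∧
      ∀ (σ : absoluteGaloisGroup ℚ) (P : W.geomTorsion p),
        (β (σ • P) : Skinner2016.CurveCoeffModule (p := p) W D.ι) =
          Skinner2016.curveCoeffRep W D.ι σ (β P : Skinner2016.CurveCoeffModule (p := p) W D.ι) := by
  classical
  haveI : Module.Free ℤ_[p] (padicCoeffIntegers D.ι) := D.moduleFree_coeffRing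
  -- `j : E[p] → E[p^∞]`
  have hPp : ∀ P : W.geomTorsion p, p • (P : WeierstrassCurve.geomPoints W) = 0 := fun P ↦ by
    rw [← AddSubmonoidClass.coe_nsmul, AddSubgroup.torsionBy.nsmul P]; rfl
  have hjmem : ∀ P : W.geomTorsion p, p ^ 1 • (P : WeierstrassCurve.geomPoints W) = 0 := fun P ↦ by
    rw [pow_one]; exact hPp P
  let j : W.geomTorsion p → PrimaryTorsion (WeierstrassCurve.geomPoints W) p :=
    fun P ↦ PrimaryTorsion.mk (P : WeierstrassCurve.geomPoints W) 1 (hjmem P)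
  have hjadd : ∀ P Q, j (P + Q) = j P + j Q := fun P Q ↦ PrimaryTorsion.ext rfl
  have hjsmul : ∀ (σ : absoluteGaloisGroup ℚ) P, j (σ • P) = W.primaryTorsionGaloisRep p σ (j P) :=
    fun σ P ↦ PrimaryTorsion.ext rfl
  have hjp : ∀ P, (p : ℤ_[p]) • j P = 0 := fun P ↦ by
    rw [PrimaryTorsion.natCast_smul]
    exact PrimaryTorsion.ext (by rw [PrimaryTorsion.val_nsmul, PrimaryTorsion.val_zero]; exact hPp P)
  have hj0 : ∀ P, j P = 0 → P = 0 := fun P h ↦ Subtype.ext (congrArg PrimaryTorsion.val h)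
  have hjpm : ∀ P, (p : ℤ_[p]) ^ m • j P = 0 := fun P ↦ by
    rw [← Nat.sub_add_cancel hm, pow_succ, mul_smul, hjp, smul_zero]
  -- `y ⊗ P` is `p^m`-torsion and `ϖ`-torsion
  have hpmy : (p : padicCoeffIntegers D.ι) ^ m * y = ((p : ℤ_[p]) ^ m) • y := by
    rw [Algebra.smul_def, map_pow, map_natCast]
  have hp1 : (p : padicCoeffIntegers D.ι) = (p : ℤ_[p]) • (1 : padicCoeffIntegers D.ι) := by
    rw [Algebra.smul_def, map_natCast, mul_one]
  have hbmem : ∀ P, (CoeffExtension.tmul y (j P) : Skinner2016.CurveCoeffModule (p := p) W D.ι) ∈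
      Skinner2016.CurveCoeffTorsion (p := p) W D.ι m := fun P ↦ by
    rw [Submodule.mem_torsionBy_iff, smul_tmul_eq, hpmy, ← tmul_smul_eq, hjpm, tmul_zero_eq]
  let b : W.geomTorsion p → Skinner2016.CurveCoeffTorsion (p := p) W D.ι m :=
    fun P ↦ ⟨CoeffExtension.tmul y (j P), hbmem P⟩
  have hbadd : ∀ P Q, b (P + Q) = b P + b Q := fun P Q ↦ Subtype.ext (by
    change (CoeffExtension.tmul y (j (P + Q)) : Skinner2016.CurveCoeffModule (p := p) W D.ι) =
      CoeffExtension.tmul y (j P) + CoeffExtension.tmul y (j Q)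
    rw [hjadd, tmul_add_eq])
  refine ⟨AddMonoidHom.mk' b hbadd, ?_, fun P ↦ ?_, fun σ P ↦ ?_⟩
  · -- injectivity
    refine (injective_iff_map_eq_zero _).2 fun P hP ↦ ?_
    have htP : (CoeffExtension.tmul y (j P) : CoeffExtension ℤ_[p] (padicCoeffIntegers D.ι)
        (PrimaryTorsion (WeierstrassCurve.geomPoints W) p)) = 0 := congrArg Subtype.val hP
    by_contra hP0
    have hjP : j P ≠ 0 := fun h ↦ hP0 (hj0 P h)
    obtain ⟨d, hd⟩ := exists_eq_mul_of_tmul_eq_zero (fun r hr ↦ dvd_of_smul_primaryTorsion_eq_zero hjP hr) htP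
    exact hyp d hd
  · -- `ϖ (y ⊗ P) = p ⊗ P = 1 ⊗ pP = 0`
    change D.Δ.ϖ • (CoeffExtension.tmul y (j P) : Skinner2016.CurveCoeffModule (p := p) W D.ι) = 0
    rw [smul_tmul_eq, mul_comm, hy, hp1, ← tmul_smul_eq, hjp, tmul_zero_eq]
  · -- equivariance: `σ (y ⊗ P) = y ⊗ σP`
    change (CoeffExtension.tmul y (j (σ • P)) : Skinner2016.CurveCoeffModule (p := p) W D.ι) =
      Skinner2016.curveCoeffRep W D.ι σ (CoeffExtension.tmul y (j P))
    rw [Skinner2016.curveCoeffRep_apply_tmul, hjsmul]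

/-- **`E[p] ↪ ρ̄_{g_m}` (footnote 1 of the erratum: «`ρ̄_{g_m} ≃ E[p]`»), in the form the irreducibility transfer needs.**
For a Hida member `D` of `f_E` at level `m ≥ 1` (`p ∥ N`) there is an INJECTIVE additive map `Θ : E[p] → (𝒪_m/ϖ)²` with
`Θ(σ P) = ρ̄_{g_m}(σ) Θ(P)` for every `σ ∈ Γ_ℚ`, where `ρ̄_{g_m} = residualRep D.Δ`: `Θ = Θ₀ ∘ e⁻¹ ∘ (y ⊗ ·)` with
`y ϖ = p`, `e = D.e` the member's `𝒪_m[Γ_ℚ]`-isomorphism `A_{g_m}[p^m] ≃ (E[p^∞] ⊗_{ℤ_p} 𝒪_m)[p^m]` (§3.1 (b)), `Θ₀` of §2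
(steps 1, 2). [cite: Castella2018Erratum, proof of Thm. 1.1, (b) and footnote 1 (p. 4)]
[cite: Skinner2016PacificMC, §2.6 (2-6-1) and §3.1 (b) (p. 192)] -/
theorem exists_geomTorsion_residual_hom [NeZero (W.conductorNorm ℤ / p)]
    (D : Skinner2016.HidaCongruentMember W p m) (hm : 1 ≤ m) :
    ∃ Θ : W.geomTorsion p →+ (Fin 2 → padicCoeffIntegers D.ι ⧸ Ideal.span {D.Δ.ϖ}),
      Function.Injective Θ ∧
      ∀ (σ : absoluteGaloisGroup ℚ) (P : W.geomTorsion p),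
        Θ (σ • P) = SkinnerUrban2014.residualRep D.Δ σ (Θ P) := by
  have hinj : Function.Injective (algebraMap (padicCoeffIntegers D.ι) (padicCoeffField D.ι)) :=
    Subtype.val_injective
  have hϖ : D.Δ.ϖ ≠ 0 := fun h ↦ IrrK.algebraMap_varpi_ne_zero D.Δ (by rw [h, map_zero])
  -- (`Exists.elim` rather than `obtain`: `rcases` on this existential is pathologically slow)
  refine (exists_mul_varpi_eq_natCast D.Δ).elim fun y hy2 ↦ ?_
  -- `D.e` intertwines `σ • ·` on `A_{g_m}[p^m]` with `ρ_{E,p} ⊗ 1` (the member's field (b), `D.he`)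
  have he : ∀ (σ : absoluteGaloisGroup ℚ) (a : Skinner2016.MemberTorsion D.Δ m),
      ∃ a' : Skinner2016.MemberTorsion D.Δ m,
        (a' : Cofree D.Δ.ρ (padicCoeffField D.ι)) = σ • (a : Cofree D.Δ.ρ (padicCoeffField D.ι)) ∧
        (D.e a' : Skinner2016.CurveCoeffModule (p := p) W D.ι) =
          Skinner2016.curveCoeffRep W D.ι σ (D.e a : Skinner2016.CurveCoeffModule (p := p) W D.ι) :=
    fun σ a ↦ ⟨torsionRep D.Δ.cofreeRep (((p : ℕ) : padicCoeffIntegers D.ι) ^ m) σ a, rfl, D.he σ a⟩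
  exact exists_equivariant_hom_of_transport (𝒪 := padicCoeffIntegers D.ι) (X := Cofree D.Δ.ρ (padicCoeffField D.ι))
    (N := Skinner2016.CurveCoeffModule (p := p) W D.ι) (V := Fin 2 → padicCoeffIntegers D.ι ⧸ Ideal.span {D.Δ.ϖ})
    (E := W.geomTorsion p) (G := absoluteGaloisGroup ℚ) (r := ((p : ℕ) : padicCoeffIntegers D.ι) ^ m) (ϖ := D.Δ.ϖ)
    (fun (σ : absoluteGaloisGroup ℚ) (x : Cofree D.Δ.ρ (padicCoeffField D.ι)) ↦ σ • x)
    (fun (σ : absoluteGaloisGroup ℚ) (x : Skinner2016.CurveCoeffModule (p := p) W D.ι) ↦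
      Skinner2016.curveCoeffRep W D.ι σ x)
    (fun (σ : absoluteGaloisGroup ℚ) (v : Fin 2 → padicCoeffIntegers D.ι ⧸ Ideal.span {D.Δ.ϖ}) ↦
      FramedRep.baseChangeRepresentation (Ideal.Quotient.mk (Ideal.span {D.Δ.ϖ})) D.Δ.ρ σ v)
    (exists_torsion_reduction_hom (F := padicCoeffField D.ι) D.Δ.ρ hϖ hinj) D.e he
    (exists_geomTorsion_curveCoeffTorsion_hom D hm y hy2.1 hy2.2)

end Member

end Summit.BirchSwinnertonDyer.BirchSwinnertonDyer.Theorems.SurjIrrK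

end
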